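import Literature.Probability.RandomPlanarGeometry.HexSAWPolygonCellsPolygonMoves
import Literature.Probability.RandomPlanarGeometry.HexSAWPolygonCellsStickDecomp
import Literature.Probability.RandomPlanarGeometry.HexSAWPolygonCellsHostTransfer
import HarnessLib

/-!
# Cell calculus for honeycomb polygon surgery, XXXVI: stick tops are leaves

Topic `Literature/Probability/RandomPlanarGeometry` (lane «pcv-sawmu», a-p4 g22; sequel of X `…CellsSticks`, XIX `…CellsPolygonMoves`).

Part 2 (α) of THEOREM I (HANDOFF-gen22.md §3 (b)): the admissible class {brick set, polygonal `bdry`, `#peel ≥ 2`} is closed under removing a stick top,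
which is what the induction of the decoder's CASE 1 needs besides peel stability (XXXIV) and the image formula (XXXV):
* `contact_of_mem_sdiff_peel` — every contact of a peeled hexagon `m` other than `LL m` is lex-LARGER than `m` (it was peeled earlier);
* ★ `nbrs_inter_eq_of_stickTop` — a stick top `c` (`c ∈ S \ peel S`, `UR c ∉ S`) has exactly the contact `LL c`: the lex-larger neighbours `R c`,
  `UL c` would themselves be peeled hexagons with `c` as a contact other than their `LL` and lex-smaller — impossible;
* `perim_erase_stickTop` (`perim S = perim (S.erase c) + 4`) and ★ `isPolygon_bdry_erase_stickTop` (XIX's one-contact erase move).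

Sources: N. Madras, G. Slade, *The Self-Avoiding Walk* (1993), §3.2, proof of Theorem 3.2.3 [MadrasSlade1993]; I. Jensen, J. Phys.: Conf. Ser. 42 (2006) 163
[Jensen2006HoneycombPolygons].  Label (lane): LANE INFRASTRUCTURE for the lane's step-two injection; nothing new in writing.
-/

open Finset

namespace Literature.Probability.RandomPlanarGeometry.SAW

namespace HexCell

/-- ★ **Contacts of a peeled hexagon**: if `m ∈ S \ peel S` and `x ∈ S` is adjacent to `m`, then `x = LL m` or `x` is lex-larger than `m`.
[cite: MadrasSlade1993, §3.2 (proof of Theorem 3.2.3)] -/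
theorem contact_of_mem_sdiff_peel {S : Finset Cell} {m x : Cell} (hm : m ∈ S \ peel S) (hx : x ∈ nbrs m ∩ S) :
    x = LL m ∨ (m.2 < x.2 ∨ (m.2 = x.2 ∧ m.1 < x.1)) := by
  induction S using Finset.strongInduction generalizing m x with
  | H S ih =>
    obtain ⟨m₀, hm₀⟩ : ∃ m₀, Peelable S m₀ := by
      by_contra h
      rw [peel_eq_self h, sdiff_self] at hm
      simp at hm
    obtain ⟨hxn, hxS⟩ := mem_inter.1 hx
    by_cases e : m = m₀
    · subst e
      left
      have : x ∈ nbrs m ∩ S := hx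
      rw [hm₀.1.2] at this
      exact mem_singleton.1 this
    · have hm' : m ∈ S.erase m₀ \ peel (S.erase m₀) := by
        have := hm
        rw [sdiff_peel_eq_insert hm₀, mem_insert] at this
        exact this.resolve_left e
      by_cases ex : x = m₀
      · subst ex
        right
        have hne : m ≠ x := e
        rcases hm₀.1.1.2 m (mem_sdiff.1 hm).1 with h | ⟨h1, h2⟩
        · exact Or.inl h
        · refine Or.inr ⟨h1, lt_of_le_of_ne h2 fun h3 => hne (Prod.ext h3 h1)⟩
      · exact ih _ (erase_ssubset hm₀.mem) hm' (mem_inter.2 ⟨hxn, mem_erase.2 ⟨ex, hxS⟩⟩)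

/-- ★ **A stick top is a leaf**: for `c ∈ S \ peel S` with `UR c ∉ S`, `nbrs c ∩ S = {LL c}`. [cite: MadrasSlade1993, §3.2 (proof of Theorem 3.2.3)] -/
theorem nbrs_inter_eq_of_stickTop {S : Finset Cell} {c : Cell} (hc : c ∈ S \ peel S) (hur : UR c ∉ S) : nbrs c ∩ S = {LL c} := by
  refine Subset.antisymm ?_ ?_
  · intro x hx
    rw [mem_singleton]
    rcases contact_of_mem_sdiff_peel hc hx with h | hlt
    · exact h
    · exfalso
      obtain ⟨hxn, hxS⟩ := mem_inter.1 hx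
      -- `x` is lex-larger and adjacent: `x ∈ {R c, UR c, UL c}`; it is not in the base (base hexagons are lex-smaller)
      have hxB : x ∉ peel S := fun hxB => by
        rcases lt_of_mem_peel_of_mem_sdiff hc hxB with h | ⟨h1, h2⟩ <;> omega
      have hx' : x ∈ S \ peel S := mem_sdiff.2 ⟨hxS, hxB⟩
      -- apply the contact lemma to `x` with contact `c`
      rcases contact_of_mem_sdiff_peel hx' (mem_inter.2 ⟨mem_nbrs_comm.1 hxn, (mem_sdiff.1 hc).1⟩) with h | hlt'
      · -- `c = LL x`: then `x = UR c`
        apply hur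
        have : UR c = x := by rw [h]; exact Prod.ext (by simp) (by simp)
        rw [this]; exact hxS
      · rcases hlt with h | ⟨h1, h2⟩ <;> rcases hlt' with h' | ⟨h1', h2'⟩ <;> omega
  · intro x hx
    rw [mem_singleton] at hx; subst hx
    exact mem_inter.2 ⟨by rw [mem_nbrs_iff]; simp [LL], ll_mem_of_mem_sdiff_peel hc⟩

/-- Removing a stick top costs `4` in perimeter. [cite: MadrasSlade1993, §3.2 (proof of Theorem 3.2.3)] -/
theorem perim_erase_stickTop {S : Finset Cell} {c : Cell} (hc : c ∈ S \ peel S) (hur : UR c ∉ S) :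
    perim S = perim (S.erase c) + 4 := by
  have hcS : c ∈ S := (mem_sdiff.1 hc).1
  have h1 : #(nbrs c ∩ S.erase c) = 1 := by
    have : nbrs c ∩ S.erase c = nbrs c ∩ S := by
      ext x
      simp only [mem_inter, mem_erase]
      constructor
      · rintro ⟨h1, -, h2⟩; exact ⟨h1, h2⟩
      · rintro ⟨h1, h2⟩; exact ⟨h1, fun e => self_notMem_nbrs c (e ▸ h1), h2⟩
    rw [this, nbrs_inter_eq_of_stickTop hc hur, card_singleton]
  have := perim_insert_of_contacts_eq_one (notMem_erase c S) h1
  rw [insert_erase hcS] at this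
  exact this

/-- The one-contact arc of a stick top, in the form consumed by XIX's erase move. [cite: MadrasSlade1993, §3.2 (proof of Theorem 3.2.3)] -/
theorem arc_of_stickTop {S : Finset Cell} {c : Cell} (hc : c ∈ S \ peel S) (hur : UR c ∉ S) :
    ∀ i < 6, nbrDir c (0 + i) ∈ S ↔ i < 1 := by
  intro i hi
  rw [Nat.zero_add]
  have hcon := nbrs_inter_eq_of_stickTop hc hur
  constructor
  · intro hin
    have hmem : nbrDir c i ∈ nbrs c ∩ S := mem_inter.2 ⟨nbrDir_mem_nbrs c i, hin⟩
    rw [hcon, mem_singleton] at hmem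
    have : nbrDir c i = nbrDir c 0 := by rw [hmem]; rfl
    have := nbrDir_injective_mod this
    omega
  · intro hi0
    have : i = 0 := by omega
    subst this
    have : LL c ∈ nbrs c ∩ S := by rw [hcon]; exact mem_singleton_self _
    exact (mem_inter.1 this).2

/-- ★ **Removing a stick top keeps the boundary a polygon** (for `perim S ≥ 7`). [cite: MadrasSlade1993, §3.2, proof of Theorem 3.2.3 pp. 64–65] -/
theorem isPolygon_bdry_erase_stickTop {S : Finset Cell} {c : Cell} (hS : IsBrickSet S) (hP : IsPolygon brickWallGraph (bdry S))
    (h7 : 7 ≤ perim S) (hc : c ∈ S \ peel S) (hur : UR c ∉ S) : IsPolygon brickWallGraph (bdry (S.erase c)) :=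
  isPolygon_bdry_erase hS (mem_sdiff.1 hc).1 hP h7 (arc_of_stickTop hc hur)

/-- ★ **Every peeled hexagon has a stick top above it**: for `m ∈ S \ peel S` there is `j` with `UR^j m ∈ S \ peel S` and `UR^{j+1} m ∉ S`.
[cite: MadrasSlade1993, §3.2 (proof of Theorem 3.2.3)] -/
theorem exists_stickTop_above {S : Finset Cell} {m : Cell} (hm : m ∈ S \ peel S) :
    ∃ j : ℕ, urIter m j ∈ S \ peel S ∧ UR (urIter m j) ∉ S := by
  classical
  have hmS : m ∈ S := (mem_sdiff.1 hm).1
  -- some `UR^J m` is outside `S` (rows of `S` are bounded)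
  obtain ⟨x, hxS, hmax⟩ := exists_max_image S (fun c : Cell => c.2) ⟨m, hmS⟩
  have hex : ∃ j : ℕ, urIter m j ∉ S := by
    refine ⟨(x.2 - m.2).toNat + 1, fun hin => ?_⟩
    have := hmax _ hin
    simp only [urIter] at this
    push_cast at this
    omega
  obtain ⟨j₀, hj₀, hmin⟩ : ∃ j₀, urIter m j₀ ∉ S ∧ ∀ j < j₀, urIter m j ∈ S :=
    ⟨Nat.find hex, Nat.find_spec hex, fun j hj => not_not.1 (Nat.find_min hex hj)⟩
  have hpos : 0 < j₀ := by
    rcases Nat.eq_zero_or_pos j₀ with h | h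
    · exfalso; apply hj₀; rw [h, urIter_zero]; exact hmS
    · exact h
  -- all lower chain cells are peeled hexagons
  have hchain : ∀ j, j < j₀ → urIter m j ∈ S \ peel S := by
    intro j hj
    induction j with
    | zero => rw [urIter_zero]; exact hm
    | succ j ih =>
      have ih' := ih (by omega)
      refine mem_sdiff.2 ⟨hmin _ hj, fun hB => ?_⟩
      rcases lt_of_mem_peel_of_mem_sdiff ih' hB with h1 | ⟨h1, -⟩
      · simp only [urIter] at h1; push_cast at h1; omega
      · simp only [urIter] at h1; push_cast at h1; omega
  refine ⟨j₀ - 1, hchain _ (by omega), ?_⟩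
  rw [← urIter_succ, show j₀ - 1 + 1 = j₀ by omega]
  exact hj₀

end HexCell

end Literature.Probability.RandomPlanarGeometry.SAW
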